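import Summits.AtomisticToContinuum.Crystallization.Theorems.ChartedZeroExcessLayeredLatticeLiouvilleTH
import Summits.AtomisticToContinuum.Crystallization.Theorems.ChartedZeroExcessLayeredLatticeLiouvilleTearFreeDoor
import Summits.AtomisticToContinuum.Crystallization.Theorems.ChartedZeroExcessLayeredLatticeLiouvilleTearFreeShells

/-!
# Zero-excess layered lattice Liouville — piece (B4) `BondIsoTearFreeP` BY NAME from the graph residual, and the residual CUT to the walk T1
# (decomp-a2c, prover hand 1, generation 16; critic row 603 (2)(b), skeleton T1–T3 of lens-2 g35's NODE §4)

* §1 ★★ `bondIsoTearFreeP_of_cleanBondPath : CleanBondPath aHi → CleanBondPath 1 → BondIsoTearFreeP aHi` and the literal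
  `bondIsoTearFreeP_one_of_cleanBondPath : CleanBondPath 1 → BondIsoTearFreeP 1` — part TH's piece (B4) BY NAME from the typed graph residual of
  `…TearFreeDoor` (T3 proved there);
* §2 chain surgery (`isBondChain_snoc`) and ★ `CleanWalk aHi` — THE ONE OPEN STUB (T1): from a site `x` of a clean `S` one reaches, along at most `5`
  bonds, a site `y` within `27/20` of any target `p ∈ S` with `dist p x ≤ 4`; ★★ `cleanBondPath_one_of_cleanWalk : CleanWalk 1 → CleanBondPath 1` (T2 of
  `…TearFreeShells` supplies the last two bonds), hence `bondIsoTearFreeP_one_of_cleanWalk : CleanWalk 1 → BondIsoTearFreeP 1`.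
EVIDENCE for T1 (hand-1 g16, folder num/walk.py, value iteration over the distance with the adversary choosing the direction and the scale `a ∈ [9/10, 1]`
at every step and the walker choosing a first-shell move (1 bond, covering cosine of the 12 directions `≥ 0.7071` fcc / hcp) or a second-shell move (2 bonds,
length `√2·a`): 7 bonds (5 + the terminal 2) reach Euclidean distance `4.15` (fcc) / `4.13` (hcp) `≥ 4`; first-shell moves alone reach only `3.78` / `3.74`
— the planned walk MUST use second-shell moves, as lens-2's §4 caution anticipated).  All `[folklore]`; 0 sorry.
-/

noncomputable section

open Set Metric
open Summit.AtomisticToContinuum.Crystallization.Theorems.ChartedPlanarOrderRigidityDoor (E3 IsClean)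
open Summit.AtomisticToContinuum.Crystallization.Theorems.ChartedPlanarOrderDensityDichotomy (μS)
open Summit.AtomisticToContinuum.Crystallization.Theorems.ChartedPlanarOrderCleanScaleP (IsCleanP isCleanP_one_iff)

namespace Summit.AtomisticToContinuum.Crystallization.Theorems.ChartedZeroExcessLayeredLatticeLiouville

/-! ## §XIV.1  (B4) by name from the graph residual -/

/-- ★★ **(B4) BY NAME**: `CleanBondPath aHi ∧ CleanBondPath 1 ⟹ BondIsoTearFreeP aHi` (part TH, lens-2 g35). [folklore] -/
theorem bondIsoTearFreeP_of_cleanBondPath {aHi : ℝ} (hA : CleanBondPath aHi) (h1 : CleanBondPath 1) : BondIsoTearFreeP aHi :=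
  tearFree_of_cleanBondPath hA h1

/-- ★★ **(B4) at the literal `aHi = 1` BY NAME**: `CleanBondPath 1 ⟹ BondIsoTearFreeP 1` — the hypothesis `h4` of part TH's column
`gap_and_pert_1_50_of_certs_16XH10` reduces to the clean-contact-graph residual. [folklore] -/
theorem bondIsoTearFreeP_one_of_cleanBondPath (h1 : CleanBondPath 1) : BondIsoTearFreeP 1 :=
  bondIsoTearFreeP_of_cleanBondPath h1 h1

/-! ## §XIV.2  Chain surgery and the cut of the residual to the walk T1 -/

/-- appending one bond to a chain. [folklore] -/
theorem isBondChain_snoc {S : Set E3} {x y w : E3} {k : ℕ} {z : ℕ → E3} (hz : IsBondChain S x y k z) (hw : w ∈ S) (hd : dist w y ≤ 28 / 25) :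
    IsBondChain S x w (k + 1) (fun i => if i ≤ k then z i else w) := by
  obtain ⟨h0, hk, hmem, hbond⟩ := hz
  refine ⟨by simp [h0], by simp, fun i hi => ?_, fun i hi => ?_⟩
  · by_cases hik : i ≤ k
    · simp only [if_pos hik]; exact hmem i hik
    · simp only [if_neg hik]; exact hw
  · rcases Nat.lt_succ_iff_lt_or_eq.1 hi with hlt | rfl
    · simp only [if_pos hlt.le, if_pos (Nat.succ_le_of_lt hlt)]; exact hbond i hlt
    · simp only [if_pos le_rfl, if_neg (Nat.not_succ_le_self i), hk]; exact hd

/-- ★ **`CleanWalk aHi`** — THE WALK (stub T1 of (B4)): in an `aHi`-clean configuration, from any site `x` one reaches along a chain of at most `5` bonds a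
site `y` within `27/20` of any target site `p` with `dist p x ≤ 4`.  GEOMETRY · TRUE-type at `aHi = 1` (planned greedy walk with first- AND second-shell
moves: covering cosine of the 12 first-shell directions `= 1/√2` for both patterns; value iteration reaches `4.13`) · ATTACKABLE · M.
Why it might fail: only through the constants (`5`, `27/20`, `4`); a first-shell-only walk provably does NOT suffice (reaches `3.74`). [this file, g16] -/
def CleanWalk (aHi : ℝ) : Prop :=
  ∀ S : Set E3, IsCleanP aHi (μS S) → ∀ x ∈ S, ∀ p ∈ S, dist p x ≤ 4 →
    ∃ (k : ℕ) (z : ℕ → E3) (y : E3), k ≤ 5 ∧ y ∈ S ∧ IsBondChain S x y k z ∧ dist p y ≤ 27 / 20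

/-- ★★ **THE CUT `CleanBondPath 1 ⟸ CleanWalk 1`**: T2 (`exists_two_bonds_of_dist_le`) supplies the last two bonds. [folklore] -/
theorem cleanBondPath_one_of_cleanWalk (h : CleanWalk 1) : CleanBondPath 1 := by
  intro S hS x hx p hp hd
  obtain ⟨k, z, y, hk, hy, hz, hpy⟩ := h S hS x hx p hp hd
  obtain ⟨w, hw, hwy, hpw⟩ := exists_two_bonds_of_dist_le hS hy hp hpy
  exact ⟨k + 2, _, by omega, isBondChain_snoc (isBondChain_snoc hz hw hwy) hp hpw⟩

/-- ★★ **(B4)@1 ⟸ T1**: `CleanWalk 1 ⟹ BondIsoTearFreeP 1`. [folklore] -/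
theorem bondIsoTearFreeP_one_of_cleanWalk (h : CleanWalk 1) : BondIsoTearFreeP 1 :=
  bondIsoTearFreeP_one_of_cleanBondPath (cleanBondPath_one_of_cleanWalk h)

end Summit.AtomisticToContinuum.Crystallization.Theorems.ChartedZeroExcessLayeredLatticeLiouville

end
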